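/-
Copyright (c) 2026. All rights reserved.
Released under Apache 2.0 license as described in the file LICENSE.
Authors: abc-iut cell, seat abc-iut-L4-t10 (gen 4; row «COR45-FULL-GLUECROSS», L4-lead GO m35), to the design
of abc-iut-w6-d025 (row «Cor36-LOGOBS-TELE», HANDOFF #2: the `G₁`-instantiation), over abc-iut-w5-d053's glue
family and abc-iut-w6-d023's pulled-back structure functors.
-/
import Literature.AnabelianGeometry.AbsoluteAnabelian.AbsTopIII.FrobeniusPictureMLFLogTeleFamilyThird
import Literature.AnabelianGeometry.AbsoluteAnabelian.AbsTopIII.FrobeniusPictureMLFLogTeleGlueGraph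
import Literature.AnabelianGeometry.AbsoluteAnabelian.AbsTopIII.FrobeniusPictureMLFLogGlueCrossClosure
import Literature.AnabelianGeometry.AbsoluteAnabelian.DiagramShiftInvarianceLifts
import HarnessLib

/-!
# [AbsTopIII] Cor. 3.6 (iii), second clause, telecore half — the instantiation `G₁ :=` the glue family

S. Mochizuki, *Topics in Absolute Anabelian Geometry III*, Cor. 3.6 (iii) p. 80 of the kurims manuscript
(`paper:url-5493eb38cbb7`; bib key `MochizukiAbsTopIII2015`); proof p. 81 ("the various Galois groups that
appear remain 'undisturbed'").

abc-iut-w6-d025's `logObsCompatTelecoreStmt_of_family'` (`FrobeniusPictureMLFLogTeleFamilyThird`) proves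
the telecore half of Cor. 3.6 (iii), second clause — `LogObsCompatTelecoreStmt τ` — for every `(Δ, τ)`
with `id_⋎` fully faithful, GIVEN a family `G₁` of homotopies on the telecore-free sub-diagram
`jS^*𝒟_An` whose homotopies lie over `ℰ` and which contains the `𝔖_log` family `H₃` along `logToF`.
This file supplies THE `G₁`: abc-iut-w5-d053's glue family `glueFamily H₃ hH₃.1 hcross` on `𝒟`
(`FrobeniusPictureMLFLogGlueFamily`) pulled back along `jD : Γ⃗_𝒮 → Γ⃗_𝒟` and transported along the
diagram equality `jS^*𝒟_An = jD^*𝒟` (abc-iut-w6-d025, `FrobeniusPictureMLFLogTeleGlueGraph`):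

* generic toolkit (`DiagramOfCategories.OverData`): over-ness is reflected by post-whiskering
  (`IsOver.of_whiskerRight`, the converse of `IsOver.whiskerRight`), transfers along `F^*`
  (`isOver_comapAlong_iff`, over abc-iut-w6-d023's `OverData.comapAlong` / `pathIso_comapAlong`) and
  along equalities of diagrams (`isOver_cast_iff`); the homotopies of a universal family lie over the
  structure functors (`univFamily_isOver`);
* `heq_teleOverE_comapAlong_jS` — the structure functors over `ℰ` of `𝒟_An` and of `𝒟` agree on `Γ⃗_𝒮`;
* `isOver_glueη` — **every glued homotopy lies over `ℰ`**: on pairs into a core vertex it is the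
  universal homotopy (a whiskered lift); on log pairs into `𝒩` the cross identity `hcross`, post-composed
  with `𝒩 → ℰ`, exhibits `glueη ▷ (𝒩 → ℰ)` as the glued homotopy of a pair INTO `ℰ`, which is over, and
  over-ness is reflected by post-whiskering;
* `glueTele` (= `G₁`), `compatibleAlong_logToF_glueTele` (= `hlog`), `glueTele_isOver` (= `hover`);
* `LogFrobeniusData.logObsCompatTelecoreStmt_of_glueCross (τ) (hν) (hH₃) (hcross)`,
  `…_of_iotaOverGalois (τ) (hν) (hH₃) (hι)`, `…_of_iotaOverGaloisStmt (τ) (hν) (hι)` — **Cor. 3.6 (iii),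
  second clause, telecore half, for every `(Δ, τ)` with `id_⋎` fully faithful satisfying
  `IotaOverGaloisStmt`** (F-0360; proved at the MLF model and at the archimedean models).

Pure category theory over the abstract data `LogFrobeniusData`; nothing here takes a side on
inter-universal Teichmüller theory or bears on [IUTchIII] Cor. 3.12.
-/

namespace Literature.AnabelianGeometry.AbsoluteAnabelian

open _root_.CategoryTheory _root_.Quiver

universe v u w

namespace DiagramOfCategories

variable {V : Type w} [Quiver.{v} V] {D : DiagramOfCategories.{v, u, w} V}
  {V' : Type w} [Quiver.{v} V']

namespace OverData

variable {C : Type u} [Category.{v} C] (O : D.OverData C)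

/-- Right whiskering commutes with `eqToHom` (bookkeeping for the re-typing along `𝒟_[σ∘γ] = 𝒟_[σ] ∘ 𝒟_[γ]`,
Def. 3.5 (i)). [cite: MochizukiAbsTopIII2015, Definition 3.5 (i) p.75] -/
private theorem whiskerRight_eqToHom'' {A B : Type u} [Category.{v} A] [Category.{v} B]
    {F G : A ⥤ B} (e : F = G) (N : B ⥤ C) :
    Functor.whiskerRight (eqToHom e) N = eqToHom (by rw [e]) := by
  subst e
  rw [eqToHom_refl, eqToHom_refl, Functor.whiskerRight_id']

variable {O} in
/-- **Over-ness is reflected by post-whiskering** (converse of `IsOver.whiskerRight`): if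
`θ ▷ 𝒟_[σ]` (re-typed along `𝒟_[σ∘γ] = 𝒟_[σ] ∘ 𝒟_[γ]`) is over `([σ]∘[γ₁], [σ]∘[γ₂])`, then `θ` is over
`([γ₁], [γ₂])` — the structure isomorphism `pathIso σ : 𝒟_[σ] ⋙ N_d ≅ N_b` is natural in `θ` and
invertible. [cite: MochizukiAbsTopIII2015, Definition 3.5 (ii) p.75] -/
theorem IsOver.of_whiskerRight {a b d : V} {P Q : Path a b} {θ : D.pathFunctor P ⟶ D.pathFunctor Q}
    (s : Path b d)
    (h : O.IsOver (P.comp s) (Q.comp s)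
      (eqToHom (D.pathFunctor_comp P s) ≫ Functor.whiskerRight θ (D.pathFunctor s) ≫
        eqToHom (D.pathFunctor_comp Q s).symm)) :
    O.IsOver P Q θ := by
  unfold IsOver at h ⊢
  rw [Functor.whiskerRight_comp, Functor.whiskerRight_comp, whiskerRight_eqToHom'',
    whiskerRight_eqToHom'', O.pathIso_comp_eq P s, O.pathIso_comp_eq Q s] at h
  change eqToHom _ ≫ Functor.whiskerRight θ (D.pathFunctor s ⋙ O.N d) ≫ eqToHom _ = _ at h
  have hn : Functor.whiskerRight θ (D.pathFunctor s ⋙ O.N d) =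
      (Functor.isoWhiskerLeft (D.pathFunctor P) (O.pathIso s)).hom ≫ Functor.whiskerRight θ (O.N b) ≫
        (Functor.isoWhiskerLeft (D.pathFunctor Q) (O.pathIso s)).inv := by
    ext x
    simp only [Functor.whiskerRight_app, NatTrans.comp_app, Functor.isoWhiskerLeft_hom,
      Functor.isoWhiskerLeft_inv, Functor.whiskerLeft_app, Functor.comp_map]
    have := (O.pathIso s).hom.naturality (θ.app x)
    simp only [Functor.comp_map] at this
    rw [← Category.assoc]
    exact (Iso.eq_comp_inv ((O.pathIso s).app ((D.pathFunctor Q).obj x))).mpr this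
  rw [hn] at h
  simp only [Iso.trans_hom, Iso.trans_inv, eqToIso.hom, eqToIso.inv, Category.assoc, cancel_epi] at h
  -- `h : θ ▷ N_b ≫ (tail) = pathIso P ≫ pathIso Q⁻¹ ≫ (tail)` with an invertible tail
  rw [← Category.assoc (O.pathIso P).hom (O.pathIso Q).inv] at h
  exact (cancel_mono _).1 h

/-- **Over-ness along `F^*`**: a homotopy of `F^*𝒟` is over `F^*(N, μ)` iff, re-typed along
`(F^*𝒟)_{[γ]} = 𝒟_{F[γ]}`, it is over `(N, μ)` on the image pair.
[cite: MochizukiAbsTopIII2015, Definition 3.5 (ii) p.75] -/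
theorem isOver_comapAlong_iff (F : V' ⥤q V) {a b : V'} (P Q : Path a b)
    (θ : (D.comapAlong F).pathFunctor P ⟶ (D.comapAlong F).pathFunctor Q) :
    (O.comapAlong F).IsOver P Q θ ↔
      O.IsOver (F.mapPath P) (F.mapPath Q)
        (eqToHom (D.pathFunctor_comapAlong F P).symm ≫ θ ≫ eqToHom (D.pathFunctor_comapAlong F Q)) := by
  unfold IsOver
  rw [O.pathIso_comapAlong F P, O.pathIso_comapAlong F Q, Functor.whiskerRight_comp,
    Functor.whiskerRight_comp, whiskerRight_eqToHom'', whiskerRight_eqToHom'']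
  simp only [Iso.trans_hom, Iso.trans_inv, eqToIso.hom, eqToIso.inv, Category.assoc]
  rw [eqToHom_comp_iff, comp_eqToHom_iff]
  simp only [Category.assoc]

omit [Quiver.{v} V'] in
/-- **Over-ness along an equality of diagrams** with (heterogeneously) equal structure functors.
[cite: MochizukiAbsTopIII2015, Definition 3.5 (ii) p.75] -/
theorem isOver_cast_iff {D₁ D₂ : DiagramOfCategories.{v, u, w} V} (hD : D₁ = D₂) {O₁ : D₁.OverData C}
    {O₂ : D₂.OverData C} (hO : HEq O₁ O₂) {a b : V} {P Q : Path a b}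
    {θ₁ : D₁.pathFunctor P ⟶ D₁.pathFunctor Q} {θ₂ : D₂.pathFunctor P ⟶ D₂.pathFunctor Q}
    (hθ : HEq θ₁ θ₂) : O₁.IsOver P Q θ₁ ↔ O₂.IsOver P Q θ₂ := by
  subst hD
  cases hO
  cases hθ
  exact Iff.rfl

/-- **The homotopies of a universal family lie over the structure functors** (they are whiskered
lifts, Def. 3.5 (iv) (b)). [cite: MochizukiAbsTopIII2015, Definition 3.5 (iv) p.76] -/
theorem univFamily_isOver (W : V → Prop) (hW : ∀ w, W w → (O.N w).FullyFaithful)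
    {a b : V} {P Q : Path a b} (h : (univFamily O W hW).E P Q) :
    O.IsOver P Q ((univFamily O W hW).η h) := by
  rcases id h with ⟨⟨w, hw, p, q, s, hP, hQ⟩⟩
  subst hP hQ
  rw [univFamily_η_eq O W hW h ⟨w, hw, p, q, s, rfl, rfl⟩]
  exact (isOver_lift (O := O) (hW w hw) p q).whiskerRight s

variable {O} in
/-- Over-ness is invariant under re-indexing the pair and the homotopy heterogeneously (bookkeeping).
[cite: MochizukiAbsTopIII2015, Definition 3.5 (ii) p.75] -/
theorem IsOver.of_heq {a b : V} {P P' Q Q' : Path a b} (hP : P = P') (hQ : Q = Q')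
    {θ : D.pathFunctor P ⟶ D.pathFunctor Q} {θ' : D.pathFunctor P' ⟶ D.pathFunctor Q'} (hθ : HEq θ θ')
    (h : O.IsOver P Q θ) : O.IsOver P' Q' θ' := by
  subst hP hQ
  cases hθ
  exact h

end OverData

/-- Pre-whiskering with `𝒟_[∅] = 𝟭` (the functor of the length-zero path, Def. 3.5 (i)) does nothing,
heterogeneously along `pathFunctor_nil`. [cite: MochizukiAbsTopIII2015, Definition 3.5 (i) p.75] -/
theorem heq_whiskerLeft_pathFunctor_nil {a b : V} {F G : D.obj a ⥤ D.obj b} (Z : F ⟶ G) :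
    HEq (Functor.whiskerLeft (D.pathFunctor (Path.nil : Path a a)) Z) Z := by
  rw [pathFunctor_nil]
  rfl

end DiagramOfCategories

/-! ### The instantiation at the data of Cor. 3.6 / 4.5 -/

namespace LogFrobeniusData

open DiagramOfCategories

variable (Δ : LogFrobeniusData.{u}) (τ : Δ.TelecoreData)

/-- **The structure functors over `ℰ` of `𝒟_An` and of `𝒟` agree on the telecore-free graph `Γ⃗_𝒮`**
(vertex by vertex `overE4`/`Anab → ℰ` versus `overE`; edge by edge, `κ_An ↦ κ_An ⋙ (Anab → ℰ) ≅ 𝟭`).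
[cite: MochizukiAbsTopIII2015, Corollary 3.6 (ii) p.80] -/
theorem heq_teleOverE_comapAlong_jS :
    HEq ((Δ.teleOverE τ).comapAlong jS.{u}) (Δ.overE.comapAlong jD.{u}) := by
  refine OverData.heq_of_eq (Δ.teleDiagram_comapAlong_jS τ) (fun x => ?_) (fun x y e => ?_)
  · obtain ⟨v⟩ := x
    rcases v with ⟨_ | _ | _ | _ | _ | _, _⟩ | _ <;> exact HEq.rfl
  · obtain ⟨a⟩ := x
    obtain ⟨b⟩ := y
    revert e
    rcases a with ⟨_ | _ | _ | _ | _ | _, _⟩ | _ <;> rcases b with _ | _ <;> intro e <;>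
      first | exact (PEmpty.elim e) | exact HEq.rfl

/-- Core vertices are the vertices of rows `≥ 4`. [cite: MochizukiAbsTopIII2015, Corollary 3.6 (i) p.78] -/
theorem coreVertices_iff_le_row (b : LFVertex) : coreVertices b ↔ 4 ≤ b.row := by
  cases b <;> simp [coreVertices, LFVertex.row]

/-- A path out of a core vertex stays among the core vertices.
[cite: MochizukiAbsTopIII2015, Corollary 3.6 (i) p.78] -/
theorem coreVertices_of_path {w b : LFVertex} (hw : coreVertices w) (s : Path w b) : coreVertices b :=
  (coreVertices_iff_le_row b).mpr (((coreVertices_iff_le_row w).mp hw).trans (LFVertex.row_le_of_path s))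

section Glue

variable {Δ}
variable {H₃ : Δ.sub3.HomotopyFamily} (hH₃ : Δ.IsLogObservableFamily H₃)
variable (hcross : ∀ ⦃a c d : LFVertex⦄ ⦃P Q : Path a LFVertex.third⦄ (h : Δ.GlueE P Q) (r₁ : Path c a)
  (r₂ : Path LFVertex.third d), coreVertices d →
  Δ.glueη H₃ hH₃.1 (Δ.isSaturated_glueE.precomp (Δ.isSaturated_glueE.postcomp h r₂) r₁) =
    eqToHom (by rw [pathFunctor_comp, pathFunctor_comp]) ≫
      Functor.whiskerLeft (Δ.diagram.pathFunctor r₁)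
        (Functor.whiskerRight (Δ.glueη H₃ hH₃.1 h) (Δ.diagram.pathFunctor r₂)) ≫
      eqToHom (by rw [pathFunctor_comp, pathFunctor_comp]))
include hcross

/-- **Every glued homotopy lies over `ℰ`.**  On a pair into a core vertex the glued homotopy is the
universal one (a whiskered lift, over by `univFamily_isOver`); on a pair into `𝒩` the cross identity,
with `r₁ = ∅`, `r₂ = (𝒩 → ℰ)`, exhibits `glueη ▷ (𝒩 → ℰ)` as the glued homotopy of the pair post-composed
INTO `ℰ`, which is over — and over-ness is reflected by post-whiskering; no glued pair ends in rows 1–2.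
[cite: MochizukiAbsTopIII2015, Corollary 3.6 (iii) p.81] -/
theorem isOver_glueη {a b : LFVertex} {P Q : Path a b} (h : Δ.GlueE P Q) :
    Δ.overE.IsOver P Q (Δ.glueη H₃ hH₃.1 h) := by
  by_cases hb : coreVertices b
  · rw [Δ.glueη_of_coreVertices H₃ hH₃.1 hb h]
    exact OverData.univFamily_isOver Δ.overE coreVertices Δ.coreVertices_fullyFaithful _
  · obtain rfl : b = LFVertex.third := by
      have h' := h
      rcases h' with hu | _
      · obtain ⟨d⟩ := hu
        exact absurd (coreVertices_of_path d.mem d.s) hb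
      · rfl
    let s : Path LFVertex.third LFVertex.fourth :=
      (LFVertex.edge34 : LFVertex.third ⟶ LFVertex.fourth).toPath
    have h₄ : Δ.GlueE (Path.nil.comp (P.comp s)) (Path.nil.comp (Q.comp s)) :=
      Δ.isSaturated_glueE.precomp (Δ.isSaturated_glueE.postcomp h s) Path.nil
    have hc := hcross h Path.nil s (Or.inl rfl)
    have ho : Δ.overE.IsOver _ _ (Δ.glueη H₃ hH₃.1 h₄) := by
      rw [Δ.glueη_of_coreVertices H₃ hH₃.1 (Or.inl rfl) h₄]
      exact OverData.univFamily_isOver Δ.overE coreVertices Δ.coreVertices_fullyFaithful _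
    have ho' : Δ.overE.IsOver (P.comp s) (Q.comp s)
        (eqToHom (Δ.diagram.pathFunctor_comp P s) ≫
          Functor.whiskerRight (Δ.glueη H₃ hH₃.1 h) (Δ.diagram.pathFunctor s) ≫
          eqToHom (Δ.diagram.pathFunctor_comp Q s).symm) := by
      refine OverData.IsOver.of_heq (Path.nil_comp _) (Path.nil_comp _) ?_ ho
      rw [hc]
      exact (HomotopyFamily.heq_eqToHom_comp_comp_eqToHom _ _ _).trans
        ((heq_whiskerLeft_pathFunctor_nil _).trans
          (HomotopyFamily.heq_eqToHom_comp_comp_eqToHom _ _ _).symm)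
    exact OverData.IsOver.of_whiskerRight s ho'

/-- **`hlog`**: the `𝔖_log` family lies, along `logToF`, in the glue family pulled back to `jS^*𝒟_An`
(abc-iut-w5-d053's `compatibleAlong_embLog_glueFamily`, `embLog = jD ∘ logToF`).
[cite: MochizukiAbsTopIII2015, Corollary 3.6 (iii) p.80] -/
theorem compatibleAlong_logToF_glueTele :
    H₃.CompatibleAlong logToF
      ((Δ.teleDiagram_comapAlong_jS τ).symm ▸ (Δ.glueFamily H₃ hH₃.1 hcross).comap jD) := by
  intro a b p q h
  have hc := compatibleAlong_embLog_glueFamily hH₃ hcross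
  rw [← logToF_comp_jD] at hc
  obtain ⟨h', hη⟩ := hc p q h
  have h'' : (Δ.glueFamily H₃ hH₃.1 hcross).E (jD.mapPath (logToF.mapPath p))
      (jD.mapPath (logToF.mapPath q)) := by
    rw [← Prefunctor.mapPath_comp_apply, ← Prefunctor.mapPath_comp_apply]
    exact h'
  refine ⟨(HomotopyFamily.cast_E_iff _ _ _ _).mpr ((HomotopyFamily.comap_E_iff _ _ _ _).mpr h''), ?_⟩
  refine hη.trans (HEq.trans ?_ (HomotopyFamily.cast_η_heq _ _ _).symm)
  rw [HomotopyFamily.comap_η]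
  exact (HomotopyFamily.η_heq_η _ (Prefunctor.mapPath_comp_apply _ _ _)
      (Prefunctor.mapPath_comp_apply _ _ _) h' h'').trans
    (HomotopyFamily.heq_eqToHom_comp_comp_eqToHom _ _ _).symm

/-- **`hover`**: every homotopy of the pulled-back glue family, as a tail homotopy of `𝒟_An`, lies over
`ℰ`. [cite: MochizukiAbsTopIII2015, Corollary 3.6 (iii) p.81] -/
theorem glueTele_isOver {x y : FVtx.{u}} {p q : Path x y}
    (h : ((Δ.teleDiagram_comapAlong_jS τ).symm ▸ (Δ.glueFamily H₃ hH₃.1 hcross).comap jD).E p q) :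
    (Δ.teleOverE τ).IsOver (jS.mapPath p) (jS.mapPath q)
      (Δ.tailη τ ((Δ.teleDiagram_comapAlong_jS τ).symm ▸ (Δ.glueFamily H₃ hH₃.1 hcross).comap jD) h) := by
  have hE := (HomotopyFamily.cast_E_iff _ _ p q).mp h
  rw [tailη]
  refine ((Δ.teleOverE τ).isOver_comapAlong_iff jS p q _).mp ?_
  refine (OverData.isOver_cast_iff (Δ.teleDiagram_comapAlong_jS τ).symm
    (Δ.heq_teleOverE_comapAlong_jS τ).symm (HomotopyFamily.cast_η_heq _ _ h).symm).mp ?_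
  refine (Δ.overE.isOver_comapAlong_iff jD p q _).mpr ?_
  rw [HomotopyFamily.comap_η]
  simp only [Category.assoc, eqToHom_trans, eqToHom_refl, Category.comp_id, eqToHom_trans_assoc,
    Category.id_comp]
  exact isOver_glueη hH₃ hcross hE

/-- **[AbsTopIII] Cor. 3.6 (iii), second clause, TELECORE half — from the cross identity** (the glue
family's whisker law for log pairs post-composed into a core vertex; its content is `IotaOverGaloisStmt`):
for every `(Δ, τ)` with `id_⋎` fully faithful, the telecore `𝔗_An` over `ℰ` and ONE family on `𝒟_An`
containing `𝒥` and `𝔖_log` — abc-iut-w6-d025's `logObsCompatTelecoreStmt_of_family'` fed with the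
pulled-back glue family. [cite: MochizukiAbsTopIII2015, Corollary 3.6 (iii) p.80] -/
theorem logObsCompatTelecoreStmt_of_glueCross (hν : Δ.toNexus.FullyFaithful) :
    Δ.LogObsCompatTelecoreStmt τ :=
  Δ.logObsCompatTelecoreStmt_of_family' τ
    ((Δ.teleDiagram_comapAlong_jS τ).symm ▸ (Δ.glueFamily H₃ hH₃.1 hcross).comap jD) hν
    (fun _ _ _ _ h => glueTele_isOver τ hH₃ hcross h) H₃ hH₃ (compatibleAlong_logToF_glueTele τ hH₃ hcross)

end Glue

variable {Δ} in
/-- **[AbsTopIII] Cor. 3.6 (iii), second clause, telecore half, for a log-observable family, FROM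
`IotaOverGaloisStmt`** (the cross identity by abc-iut-w5-d053's `glueCross_of_mapPath` /
`imageCross_of_generators` / `generatorCross_of_iotaOverGalois`).
[cite: MochizukiAbsTopIII2015, Corollary 3.6 (iii) p.80] -/
theorem logObsCompatTelecoreStmt_of_iotaOverGalois {H₃ : Δ.sub3.HomotopyFamily}
    (hH₃ : Δ.IsLogObservableFamily H₃) (hν : Δ.toNexus.FullyFaithful) (hι : Δ.IotaOverGaloisStmt) :
    Δ.LogObsCompatTelecoreStmt τ :=
  logObsCompatTelecoreStmt_of_glueCross τ hH₃
    (Δ.glueCross_of_mapPath H₃ hH₃.1 fun _ _ r p q hh _ r₂ hd h' =>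
      imageCross_of_generators hH₃ (generatorCross_of_iotaOverGalois hH₃ hι) ((hH₃.1 p q).mp hh)
        r hh r₂ hd h') hν

/-- **[AbsTopIII] Cor. 3.6 (iii), second clause («the family of homotopies that constitutes `𝔖_log` is
compatible with the families of homotopies that constitute the core and telecore structures of (i),
(ii)»), TELECORE half, for EVERY `(Δ, τ)` with `id_⋎` fully faithful satisfying `IotaOverGaloisStmt`**
(F-0360; the `𝔖_log` family exists by `observableLogStmt`).  With abc-iut-w5-d053's cores half
(`logObsCompatCoresStmt_of_iotaOverGaloisStmt`) this is the whole second clause.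
[cite: MochizukiAbsTopIII2015, Corollary 3.6 (iii) p.80] -/
theorem logObsCompatTelecoreStmt_of_iotaOverGaloisStmt (hν : Δ.toNexus.FullyFaithful)
    (hι : Δ.IotaOverGaloisStmt) : Δ.LogObsCompatTelecoreStmt τ := by
  obtain ⟨H₃, hH₃⟩ := Δ.observableLogStmt
  exact Δ.logObsCompatTelecoreStmt_of_iotaOverGalois τ hH₃ hν hι

end LogFrobeniusData

end Literature.AnabelianGeometry.AbsoluteAnabelian
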